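import Literature.AlgebraicGeometry.Motives.GrassmannianProjective
import Literature.AlgebraicGeometry.Motives.GrassmannianGLActionOver
import Literature.AlgebraicGeometry.Morphisms.ProjectiveMorphismComposition
import Literature.AlgebraicGeometry.HodgeTheory.GlobalInvariantCycles
import HarnessLib

/-!
# The Grassmannian over a base: `Gr(k, M)_S → S` is projective; over a field it is (quasi-)projective in the tree's currency

Topic `AlgebraicGeometry/Motives`; namespace `Literature.AlgebraicGeometry.Motives.Grassmannian`.  THEOREMS ONLY (no definition,
no instance, no notation, no named fact, no `sorry`).

[GortzWedhorn2020, Cor. 8.15 / (8.10) Prop. 8.23 with (13.8)/Summary 13.71: the Grassmannian is projective over `ℤ`, hence over any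
base by base change] — in the tree: ★ (A13) `Grassmannian.isProjective_terminal_from` (B-p09 (g13), on top of the Plücker chain) says
`grassmannianScheme M k → Spec ℤ` is H-projective; ★ `IsProjective.of_isPullback` (B-p10 (g11), Hartshorne II Ex. 4.9 / Stacks 01WF)
transports projectivity along the cartesian square `S × Gr → S` (Mathlib `IsPullback.of_hasBinaryProduct'`):

* **`isProjective_GrOver_hom (S) : IsProjective (GrOver M k S).hom`** — `Gr(k, M)_S → S` is H-projective for EVERY base scheme `S`
  (`GrOver M k S = S × Gr(k, M)`, ★ `Motives/GrassmannianGLActionOver`); `isProper_GrOver_hom`;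
* over a field `K`: with `GrOverField M k K : Motives.SchemeOver K` (= `Over.mk (GrOver M k (Spec K)).hom`),
  **`isProjectiveOver_grassmannian (K) : Motives.IsProjectiveOver (GrOverField M k K)`** (★ `IsProjective.isProjectiveOver`) and
  **`isQuasiProjectiveOver_grassmannian (K) : HodgeTheory.IsQuasiProjectiveOver (GrOverField M k K)`** — the (F)-currency reading
  (F-5 (d) / F-9 consumers, `Spec ℚ` included).

Cell `hodgecm-mathlib` (D-0151), F-DAG capital (B-plan1 (g16) 06:41:34Z (γ)); nothing here is about HC — HC_CM is proved only modulo the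
7 printed citations until rung 0 closes.

## References
* [GortzWedhorn2020] U. Görtz, T. Wedhorn, *Algebraic Geometry I*, 2nd ed. (2020), Cor. 8.15 (p. 216), (8.10) Prop. 8.23 (p. 220).
* [Hartshorne1977] R. Hartshorne, *Algebraic Geometry* (1977), II §4 Definition p.103 (projective morphism), II Ex. 4.9.
* [StacksProject] The Stacks project, Tag 01WF (base change of projective morphisms), Tag 089T.
-/

set_option autoImplicit false

noncomputable section

universe u

open CategoryTheory CategoryTheory.Limits _root_.AlgebraicGeometry
open Literature.AlgebraicGeometry.Morphisms

namespace Literature.AlgebraicGeometry.Motives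

namespace Grassmannian

variable (M : Type u) [AddCommGroup M] (k : ℕ) [Module.Finite ℤ M] [Module.Free ℤ M]
  [(grassmannianSheaf M k).obj.IsRepresentable] [(grassmannianSheaf (⋀[ℤ]^k M) 1).obj.IsRepresentable]

/-- **`Gr(k, M)_S → S` IS PROJECTIVE FOR EVERY BASE SCHEME `S`** (H-projective, Hartshorne II §4): base change of ★ (A13) along the
cartesian square `S × Gr(k, M) → S` over `Gr(k, M) → Spec ℤ` (★ `IsProjective.of_isPullback`, Mathlib `IsPullback.of_hasBinaryProduct'`).
[cite: GortzWedhorn2020, (8.10) Prop. 8.23 (p. 220)] [cite: StacksProject, Tag 01WF] -/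
theorem isProjective_GrOver_hom (S : Scheme.{u}) : IsProjective (GrOver M k S).hom := by
  rw [GrOver_hom]
  exact IsProjective.of_isPullback (IsPullback.of_hasBinaryProduct' S (grassmannianScheme M k)).flip
    (isProjective_terminal_from M k)

/-- `Gr(k, M)_S → S` is proper. [cite: GortzWedhorn2020, (8.10) Prop. 8.23 (p. 220)] -/
theorem isProper_GrOver_hom (S : Scheme.{u}) : IsProper (GrOver M k S).hom :=
  (isProjective_GrOver_hom M k S).isProper

/-- **Over a field `K`: the Grassmannian `Gr(k, M)_K` is projective over `K` in the tree's `Motives.IsProjectiveOver` currency**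
(closed `K`-immersion into some `ℙⁿ_K`; ★ `IsProjective.isProjectiveOver`). [cite: GortzWedhorn2020, (8.10) Prop. 8.23 (p. 220)]
[cite: Hartshorne1977, II §4 Definition p.103 (projective morphism)] -/
theorem isProjectiveOver_grassmannian (K : Type u) [Field K] :
    Motives.IsProjectiveOver (Over.mk (GrOver M k (Spec (CommRingCat.of K))).hom : Motives.SchemeOver K) :=
  IsProjective.isProjectiveOver (isProjective_GrOver_hom M k (Spec (CommRingCat.of K)))

/-- **Over a field `K`: `Gr(k, M)_K` is quasi-projective over `K`** (`HodgeTheory.IsQuasiProjectiveOver`, the currency of the (F)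
statement `lan2013_siegelFineModuliScheme`). [cite: GortzWedhorn2020, (8.10) Prop. 8.23 (p. 220)] -/
theorem isQuasiProjectiveOver_grassmannian (K : Type u) [Field K] :
    HodgeTheory.IsQuasiProjectiveOver (Over.mk (GrOver M k (Spec (CommRingCat.of K))).hom : Motives.SchemeOver K) :=
  HodgeTheory.IsQuasiProjectiveOver.of_isProjectiveOver (isProjectiveOver_grassmannian M k K)

end Grassmannian

end Literature.AlgebraicGeometry.Motives

end
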